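import Summits.Ventures.CertifiedQuantumChemistry.Rows.SingletRows
import Literature.MathematicalPhysics.QuantumLattice.SymmetryProjectedVariationalBound
import Literature.MathematicalPhysics.QuantumLattice.HubbardSpinReflectionSignRule
import HarnessLib

/-!
# Ventures/CertifiedQuantumChemistry — Rows/SingletUpperSpinBound.lean: singlet UPPER rows from spin-contaminated trial states

HONEST FRAMING (verbatim): certified bounds for a stated model Hamiltonian in a stated basis; not a
claim about the real molecule beyond that model.

Soundness of the var-2 singlet-U object (cell rulings U-20b, FORMAT-qcmps0 §4b; var-2's Lean-side
note 2026-08-21T03:21:36Z). A trial vector `ψ` of the central sector `(N_α, N_β) = (n, n)` produced by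
an `S_z`-adapted method (MPS/DMRG) is in general NOT a singlet, so its Rayleigh quotient bounds
`Model.energy F n n` (`UpperRow`) but not the larger singlet quantity
`Model.singletEnergy F n = E₀(H_F; N = 2n, S = 0)` (`SingletUpperRow`). With a certified bound
`s ≥ ‖Ŝ_+ψ‖² = ⟨ψ, Ŝ_−Ŝ_+ψ⟩ (= ⟨ψ, Ŝ²ψ⟩ on S_z = 0)` on its spin contamination and ANY certified lower
bound `B ≤ Model.energy F n n` of the SECTOR energy (a `LowerRow F n n B`), one still gets a singlet
upper row:

  `E₀(N = 2n, S = 0) · (⟨ψ,ψ⟩ − s/2) ≤ Re⟨ψ, H_F ψ⟩ − B · s/2`   (`Model.singletEnergy_mul_le_of_spin_bound`)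

hence `E₀(N = 2n, S = 0) ≤ (Re⟨ψ,H_Fψ⟩ − B s/2)/(⟨ψ,ψ⟩ − s/2)` whenever `⟨ψ,ψ⟩ > s/2`
(`singletUpperRow_of_spinCertificate`). PROOF (all PROVED here, no named fact): split
`ψ = ψ₀ + ψ₁` with `ψ₀ = P ψ`, `P = P_{S=0}` the orthogonal projection onto `ker Ŝ²` (tree
`SymmetryProjection.singletProj`), `ψ₁ = (1 − P)ψ`; (i) `[H_F, Ŝ²] = 0` (T-05,
`molecularHamiltonian_commute_spinSq`) ⇒ `[H_F, P] = 0` ⇒ `⟨ψ,H_Fψ⟩ = ⟨ψ₀,H_Fψ₀⟩ + ⟨ψ₁,H_Fψ₁⟩` and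
`⟨ψ,ψ⟩ = ⟨ψ₀,ψ₀⟩ + ⟨ψ₁,ψ₁⟩`; (ii) THE GAP LEMMA `⟨ψ₁, Ŝ²ψ₁⟩ ≥ 2⟨ψ₁,ψ₁⟩` — on `S_z = 0` vectors
`Ŝ² = Ŝ_−Ŝ_+`, and from `[Ŝ_+, Ŝ_−] = 2Ŝ_z`, `[Ŝ_z, Ŝ_+] = Ŝ_+` one gets `‖Ŝ²φ‖² ≥ 2⟨φ,Ŝ²φ⟩` for
`Ŝ_zφ = 0`, so the lowest eigenvalue `μ` of `Ŝ²` on the `Ŝ²`-invariant subspace `(1 − P)·V₀` satisfies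
`μ² ≥ 2μ`, `μ > 0`, i.e. `μ ≥ 2` (the lowest non-singlet multiplet is a triplet, `S(S+1) = 2`) — hence
`x := ⟨ψ₁,ψ₁⟩ ≤ s/2`; (iii) Rayleigh–Ritz on the singlet subspace with `ψ₀` and the sector bound on
`ψ₁`: `E_S (⟨ψ,ψ⟩ − x) ≤ Re⟨ψ,Hψ⟩ − B x`, and `B ≤ E₀(n,n) ≤ E_S`, `x ≤ s/2` give the claim.
The admissible `B` of FORMAT-qcmps0 ("E_core − Σ|c_t|") is just one `LowerRow`; any CERTIFIED sector
lower row on the same file is admissible and tighter.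

What is NOT claimed: nothing here evaluates MPS data; the certificate predicate
`SingletUpperCertificateSpin F n B hi` is an OPEN CLAIM NODE shape (W4) whose numerical content
(`Re⟨ψ,H_Fψ⟩ ≤ h`, `⟨ψ,ψ⟩ ≥ nn`, `‖Ŝ_+ψ‖² ≤ s` for an explicit `ψ`) is established outside the kernel by
the cell's two-lineage readers, exactly as for `UpperCertificate`.

References: Löwdin, Phys. Rev. 97 (1955) 1509; Tasaki (2020) §2.2, App. A.3; HJO (2000) §2.3.4. Typer gen 2 (T-04).
-/

noncomputable section

namespace Summit.Ventures.CertifiedQuantumChemistry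

open Matrix Finset
open Literature.MathematicalPhysics.QuantumLattice Literature.MathematicalPhysics.QuantumChemistry
open Literature.MathematicalPhysics.QuantumLattice.SymmetryProjection (singletProj)
open scoped ComplexOrder

/-! ## §1 Spin algebra on `S_z = 0` vectors -/

section SpinAlgebra

variable {Λ : Type*} [LinearOrder Λ] [Fintype Λ]

/-- The operator type on the spinful Fock space over `Λ` (abbreviation for the statements below). -/
abbrev SpinOp (Λ : Type*) [LinearOrder Λ] [Fintype Λ] : Type _ :=
  Matrix (Finset (Orb Λ)) (Finset (Orb Λ)) ℂ

omit [LinearOrder Λ] in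
/-- `⟨Aᴴ v, w⟩ = ⟨v, A w⟩` in `dotProduct` form. [folklore] -/
private theorem star_conjTranspose_mulVec_dotProduct (A : Matrix (Finset (Orb Λ)) (Finset (Orb Λ)) ℂ)
    (v w : Fock (Orb Λ)) : star (Aᴴ *ᵥ v) ⬝ᵥ w = star v ⬝ᵥ (A *ᵥ w) := by
  rw [star_mulVec, conjTranspose_conjTranspose, ← dotProduct_mulVec]

/-- `Ŝ_+ Ŝ_− = Ŝ_− Ŝ_+ + 2 Ŝ_z` (`[Ŝ_+, Ŝ_−] = 2Ŝ_z`, tree `LiebThm1.spinPlus_mul_spinMinus_sub`). -/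
theorem spinPlus_mul_conjTranspose_eq :
    (spinPlus * spinPlusᴴ : SpinOp Λ) = spinPlusᴴ * spinPlus + (2 : ℂ) • HubbardWave0.spinZ := by
  have h := LiebThm1.spinPlus_mul_spinMinus_sub (Λ := Λ)
  change (spinPlus * spinPlusᴴ - spinPlusᴴ * spinPlus : SpinOp Λ) = (2 : ℂ) • HubbardWave0.spinZ at h
  rw [← h]; abel

/-- `Ŝ² = Ŝ_z² + Ŝ_z + Ŝ_−Ŝ_+`. Tasaki (2020) (2.4.6)/(A.3.6). [folklore] -/
theorem spinSq_eq_spinZ_sq_add :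
    (spinSq : SpinOp Λ) =
      HubbardWave0.spinZ * HubbardWave0.spinZ + HubbardWave0.spinZ + spinPlusᴴ * spinPlus := by
  unfold spinSq
  rw [spinPlus_mul_conjTranspose_eq]
  module

/-- `Ŝ_z Ŝ_+ = Ŝ_+ Ŝ_z + Ŝ_+` (tree `LiebTwo.spinZ_mul_spinPlus_sub`). -/
theorem spinZ_mul_spinPlus_eq :
    (HubbardWave0.spinZ * spinPlus : SpinOp Λ) = spinPlus * HubbardWave0.spinZ + spinPlus := by
  have h := LiebTwo.spinZ_mul_spinPlus_sub (Λ := Λ)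
  rw [sub_eq_iff_eq_add'] at h
  rw [h]

/-- On an `S_z = 0` vector, `Ŝ²φ = Ŝ_−(Ŝ_+φ)`. -/
theorem spinSq_mulVec_of_spinZ_eq_zero {φ : Fock (Orb Λ)} (hz : HubbardWave0.spinZ *ᵥ φ = 0) :
    spinSq *ᵥ φ = spinPlusᴴ *ᵥ (spinPlus *ᵥ φ) := by
  rw [spinSq_eq_spinZ_sq_add]
  simp only [add_mulVec, ← mulVec_mulVec, hz, mulVec_zero, zero_add]

/-- `Ŝ_z (Ŝ_+ φ) = Ŝ_+ φ` when `Ŝ_z φ = 0` (`Ŝ_+` raises `S_z` by one). -/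
theorem spinZ_mulVec_spinPlus_mulVec_of_spinZ_eq_zero {φ : Fock (Orb Λ)}
    (hz : HubbardWave0.spinZ *ᵥ φ = 0) : HubbardWave0.spinZ *ᵥ (spinPlus *ᵥ φ) = spinPlus *ᵥ φ := by
  rw [mulVec_mulVec, spinZ_mul_spinPlus_eq, add_mulVec, ← mulVec_mulVec, hz, mulVec_zero, zero_add]

/-- **`‖Ŝ_−Ŝ_+φ‖² ≥ 2‖Ŝ_+φ‖²` for `Ŝ_zφ = 0`**: with `u = Ŝ_+φ` (`Ŝ_z u = u`),
`‖Ŝ_−u‖² = ⟨u, Ŝ_+Ŝ_−u⟩ = ‖Ŝ_+u‖² + 2⟨u, Ŝ_z u⟩ = ‖Ŝ_+u‖² + 2‖u‖² ≥ 2‖u‖²`. -/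
theorem two_mul_norm_spinPlus_le {φ : Fock (Orb Λ)} (hz : HubbardWave0.spinZ *ᵥ φ = 0) :
    2 * (star (spinPlus *ᵥ φ) ⬝ᵥ (spinPlus *ᵥ φ)).re ≤
      (star (spinPlusᴴ *ᵥ (spinPlus *ᵥ φ)) ⬝ᵥ (spinPlusᴴ *ᵥ (spinPlus *ᵥ φ))).re := by
  set u := spinPlus *ᵥ φ with hu
  have h1 : star (spinPlusᴴ *ᵥ u) ⬝ᵥ (spinPlusᴴ *ᵥ u) =
      star u ⬝ᵥ ((spinPlus * spinPlusᴴ : SpinOp Λ) *ᵥ u) := by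
    rw [star_conjTranspose_mulVec_dotProduct, mulVec_mulVec]
  have h2 : (spinPlus * spinPlusᴴ : SpinOp Λ) *ᵥ u = spinPlusᴴ *ᵥ (spinPlus *ᵥ u) + (2 : ℂ) • u := by
    rw [spinPlus_mul_conjTranspose_eq, add_mulVec, ← mulVec_mulVec, smul_mulVec,
      spinZ_mulVec_spinPlus_mulVec_of_spinZ_eq_zero hz]
  have h3 : star u ⬝ᵥ (spinPlusᴴ *ᵥ (spinPlus *ᵥ u)) = star (spinPlus *ᵥ u) ⬝ᵥ (spinPlus *ᵥ u) := by
    rw [← star_conjTranspose_mulVec_dotProduct, conjTranspose_conjTranspose]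
  rw [h1, h2, dotProduct_add, dotProduct_smul, h3, Complex.add_re, smul_eq_mul, Complex.mul_re]
  have h4 : 0 ≤ (star (spinPlus *ᵥ u) ⬝ᵥ (spinPlus *ᵥ u)).re :=
    (Complex.nonneg_iff.1 (dotProduct_star_self_nonneg _)).1
  have h5 : (star u ⬝ᵥ u).im = 0 := (Complex.nonneg_iff.1 (dotProduct_star_self_nonneg _)).2.symm
  simp only [Complex.re_ofNat, Complex.im_ofNat, h5, mul_zero, sub_zero]
  linarith

/-- `Ŝ²` is Hermitian (tree `LiebTwo.spinSq_conjTranspose`). -/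
theorem spinSq_isHermitian' : (spinSq : SpinOp Λ).IsHermitian := LiebTwo.spinSq_conjTranspose

/-- `Ŝ² P_{S=0} = 0`. -/
theorem spinSq_mul_singletProj : (spinSq * singletProj : SpinOp Λ) = 0 := by
  refine Matrix.toLin'.injective (LinearMap.ext fun v => ?_)
  simp only [Matrix.toLin'_apply, ← mulVec_mulVec,
    SymmetryProjection.spinSq_mulVec_singletProj_mulVec, zero_mulVec]

/-- `P_{S=0} Ŝ² = 0`. -/
theorem singletProj_mul_spinSq : (singletProj * spinSq : SpinOp Λ) = 0 := by
  have h := congrArg conjTranspose (spinSq_mul_singletProj (Λ := Λ))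
  rwa [conjTranspose_mul, SymmetryProjection.singletProj_conjTranspose, LiebTwo.spinSq_conjTranspose,
    conjTranspose_zero] at h

/-- An operator `B` with `[B, Ŝ²] = 0 = [Bᴴ, Ŝ²]` commutes with `P_{S=0}` (re-proof of the tree's
private `SymmetryProjection.singletProj_commute_of_commute`). [folklore] -/
theorem singletProj_commute_of_commute_spinSq {B : SpinOp Λ} (hB : Commute B spinSq)
    (hB' : Commute Bᴴ spinSq) : Commute singletProj B := by
  set K := LinearMap.ker (Matrix.toLin' (spinSq : SpinOp Λ)) with hK
  have hinv : ∀ C : SpinOp Λ, Commute C spinSq → ∀ v ∈ K, C *ᵥ v ∈ K := by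
    intro C hC v hv
    rw [hK, LinearMap.mem_ker, Matrix.toLin'_apply] at hv ⊢
    rw [mulVec_mulVec, ← hC.eq, ← mulVec_mulVec, hv, mulVec_zero]
  have hPh : (singletProj : SpinOp Λ)ᴴ = singletProj := SymmetryProjection.singletProj_conjTranspose
  have h1 : ∀ C : SpinOp Λ, Commute C spinSq → C * singletProj = singletProj * C * singletProj := by
    intro C hC
    refine Matrix.toLin'.injective (LinearMap.ext fun v => ?_)
    simp only [Matrix.toLin'_apply, ← mulVec_mulVec]
    exact (projMatrix_map_mulVec_of_mem K (hinv C hC _ (projMatrix_map_mulVec_mem K v))).symm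
  have h2 : (singletProj * B : SpinOp Λ) = singletProj * B * singletProj := by
    have h := congrArg conjTranspose (h1 Bᴴ hB')
    rwa [conjTranspose_mul, conjTranspose_mul, conjTranspose_mul, conjTranspose_conjTranspose, hPh,
      ← Matrix.mul_assoc] at h
  change (singletProj * B : SpinOp Λ) = B * singletProj
  rw [h2, ← h1 B hB]

/-- For `φ` in a sector `(N, S_z = 0)`, `P_{S=0}φ` is in the same sector (an `N`-particle singlet). -/
theorem singletProj_mulVec_mem_szSector {N : ℕ} {φ : Fock (Orb Λ)} (hφ : φ ∈ szSector N 0) :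
    singletProj *ᵥ φ ∈ szSector N 0 := by
  rw [mem_szSector_iff] at hφ ⊢
  refine ⟨SymmetryProjection.isNParticle_singletProj_mulVec hφ.1, ?_⟩
  obtain ⟨-, -, hZ⟩ := spin_mulVec_eq_zero_of_spinSq_mulVec_eq_zero
    (SymmetryProjection.spinSq_mulVec_singletProj_mulVec φ)
  rw [hZ, Complex.ofReal_zero, zero_smul]

/-- For `φ` in a sector `(N, S_z = 0)`, `Ŝ²φ = Ŝ_−Ŝ_+φ` is in the same sector. -/
theorem spinSq_mulVec_mem_szSector_zero {N : ℕ} {φ : Fock (Orb Λ)} (hφ : φ ∈ szSector N 0) :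
    spinSq *ᵥ φ ∈ szSector N 0 := by
  rw [mem_szSector_iff] at hφ ⊢
  have hz : HubbardWave0.spinZ *ᵥ φ = 0 := by rw [hφ.2, Complex.ofReal_zero, zero_smul]
  rw [spinSq_mulVec_of_spinZ_eq_zero hz]
  refine ⟨?_, ?_⟩
  · exact LiebTwo.isNParticle_mulVec_of_commute (LiebTwo.isNParticle_mulVec_of_commute hφ.1
      LiebTwo.totalNumber_mul_spinPlus) LiebTwo.totalNumber_mul_spinMinus
  · have hu := spinZ_mulVec_spinPlus_mulVec_of_spinZ_eq_zero hz
    have e2 : (HubbardWave0.spinZ * spinPlusᴴ : SpinOp Λ) = spinPlusᴴ * HubbardWave0.spinZ - spinPlusᴴ := by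
      have h := congrArg conjTranspose (spinZ_mul_spinPlus_eq (Λ := Λ))
      rw [conjTranspose_mul, conjTranspose_add, conjTranspose_mul, HubbardWave0.spinZ_isHermitian.eq] at h
      rw [eq_sub_iff_add_eq, ← h]
    rw [Complex.ofReal_zero, zero_smul, mulVec_mulVec, e2, sub_mulVec, ← mulVec_mulVec, hu, sub_self]

/-- **Spin-contamination bound.** For `ψ` in a sector `(N, S_z = 0)`:
`2 ‖ψ − P_{S=0}ψ‖² ≤ ‖Ŝ_+ψ‖²` (the non-singlet part of `ψ` lies in multiplets with `S(S+1) ≥ 2`). -/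
theorem two_mul_norm_sub_singletProj_le {N : ℕ} {ψ : Fock (Orb Λ)} (hψ : ψ ∈ szSector N 0) :
    2 * (star (ψ - singletProj *ᵥ ψ) ⬝ᵥ (ψ - singletProj *ᵥ ψ)).re ≤
      (star (spinPlus *ᵥ ψ) ⬝ᵥ (spinPlus *ᵥ ψ)).re := by
  classical
  set P : SpinOp Λ := singletProj with hP
  set Q : SpinOp Λ := 1 - P with hQ
  have hQv : ∀ v : Fock (Orb Λ), Q *ᵥ v = v - P *ᵥ v := fun v => by rw [hQ, sub_mulVec, one_mulVec]
  have hPP : P * P = P := SymmetryProjection.singletProj_mul_self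
  have hPh : Pᴴ = P := SymmetryProjection.singletProj_conjTranspose
  have hQh : Qᴴ = Q := by rw [hQ, conjTranspose_sub, conjTranspose_one, hPh]
  have hPQ : P * Q = 0 := by rw [hQ, mul_sub, mul_one, hPP, sub_self]
  have hS2Q : spinSq * Q = spinSq := by rw [hQ, mul_sub, mul_one, hP, spinSq_mul_singletProj, sub_zero]
  have hQS2 : Q * spinSq = spinSq := by rw [hQ, sub_mul, one_mul, hP, singletProj_mul_spinSq, sub_zero]
  have hz : ∀ {φ : Fock (Orb Λ)}, φ ∈ szSector N 0 → HubbardWave0.spinZ *ᵥ φ = 0 := fun hφ => by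
    rw [((mem_szSector_iff _ _ _).1 hφ).2, Complex.ofReal_zero, zero_smul]
  have hQmem : ∀ {φ : Fock (Orb Λ)}, φ ∈ szSector N 0 → Q *ᵥ φ ∈ szSector N 0 := fun hφ => by
    rw [hQv]; exact Submodule.sub_mem _ hφ (singletProj_mulVec_mem_szSector hφ)
  -- `⟨ψ₁, Ŝ²ψ₁⟩ = ‖Ŝ_+ψ‖²`
  set ψ₁ := ψ - P *ᵥ ψ with hψ₁
  have hψ₁Q : ψ₁ = Q *ᵥ ψ := (hQv ψ).symm
  have hray : star ψ₁ ⬝ᵥ (spinSq *ᵥ ψ₁) = star (spinPlus *ᵥ ψ) ⬝ᵥ (spinPlus *ᵥ ψ) := by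
    rw [hψ₁Q, mulVec_mulVec, hS2Q, ← hQh, star_conjTranspose_mulVec_dotProduct, mulVec_mulVec, hQS2,
      spinSq_mulVec_of_spinZ_eq_zero (hz hψ)]
    have h' := star_conjTranspose_mulVec_dotProduct (spinPlusᴴ) ψ (spinPlus *ᵥ ψ)
    rw [conjTranspose_conjTranspose] at h'
    exact h'.symm
  by_cases h0 : ψ₁ = 0
  · rw [h0, dotProduct_zero, Complex.zero_re, mul_zero]
    exact (Complex.nonneg_iff.1 (dotProduct_star_self_nonneg _)).1
  -- the `Ŝ²`-invariant subspace `W = Q · V₀`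
  set W : Submodule ℂ (Fock (Orb Λ)) := (szSector N 0).map (Matrix.toLin' Q) with hW
  have hψ₁W : ψ₁ ∈ W := Submodule.mem_map.2 ⟨ψ, hψ, by rw [Matrix.toLin'_apply, hψ₁Q]⟩
  have hWle : ∀ w ∈ W, w ∈ szSector N 0 := by
    intro w hw
    obtain ⟨φ, hφ, rfl⟩ := Submodule.mem_map.1 hw
    rw [Matrix.toLin'_apply]; exact hQmem hφ
  have hWinv : ∀ w ∈ W, spinSq *ᵥ w ∈ W := by
    intro w hw
    obtain ⟨φ, hφ, rfl⟩ := Submodule.mem_map.1 hw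
    refine Submodule.mem_map.2 ⟨spinSq *ᵥ φ, spinSq_mulVec_mem_szSector_zero hφ, ?_⟩
    rw [Matrix.toLin'_apply, Matrix.toLin'_apply, mulVec_mulVec, mulVec_mulVec, hQS2, hS2Q]
  have hWne : W ≠ ⊥ := fun hb => h0 (by simpa [hb] using hψ₁W)
  obtain ⟨v, hvW, hv1, hS2v⟩ := exists_unit_eigen_minEnergyOn spinSq_isHermitian' W hWinv hWne
  set μ : ℝ := (spinSq : SpinOp Λ).minEnergyOn W with hμ
  -- `v = Q φ₀`, so `P v = 0`; `Ŝ_z v = 0`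
  obtain ⟨φ₀, -, hvφ₀⟩ := Submodule.mem_map.1 hvW
  rw [Matrix.toLin'_apply] at hvφ₀
  have hPv : P *ᵥ v = 0 := by rw [← hvφ₀, mulVec_mulVec, hPQ, zero_mulVec]
  have hzv : HubbardWave0.spinZ *ᵥ v = 0 := hz (hWle v hvW)
  -- `μ = ‖Ŝ_+ v‖²` and `μ² ≥ 2μ`
  set u := spinPlus *ᵥ v with hu
  have hS2v' : spinPlusᴴ *ᵥ u = ((μ : ℝ) : ℂ) • v := by
    rw [hu, ← spinSq_mulVec_of_spinZ_eq_zero hzv, hS2v]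
  have hμu : (star u ⬝ᵥ u).re = μ := by
    have h : star u ⬝ᵥ u = star v ⬝ᵥ (spinPlusᴴ *ᵥ u) := by
      have h' := star_conjTranspose_mulVec_dotProduct (spinPlusᴴ) v u
      rw [conjTranspose_conjTranspose] at h'
      rw [hu] at h' ⊢
      exact h'
    rw [h, hS2v', dotProduct_smul, hv1, smul_eq_mul, mul_one, Complex.ofReal_re]
  have hineq := two_mul_norm_spinPlus_le hzv
  rw [← hu, hS2v', star_smul, smul_dotProduct, dotProduct_smul, hv1, hμu] at hineq
  have hμsq : 2 * μ ≤ μ * μ := by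
    simpa [Complex.mul_re, smul_eq_mul] using hineq
  have hμ0 : 0 ≤ μ := by rw [← hμu]; exact (Complex.nonneg_iff.1 (dotProduct_star_self_nonneg _)).1
  have hμne : μ ≠ 0 := by
    intro hm
    have hu0 : u = 0 := by
      have h1 : star u ⬝ᵥ u = 0 := by
        apply Complex.ext
        · rw [hμu, hm, Complex.zero_re]
        · rw [Complex.zero_im]; exact (Complex.nonneg_iff.1 (dotProduct_star_self_nonneg _)).2.symm
      exact dotProduct_star_self_eq_zero.1 h1
    have hS0 : spinSq *ᵥ v = 0 := by
      rw [spinSq_mulVec_of_spinZ_eq_zero hzv, ← hu, hu0, mulVec_zero]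
    have hv0 : v = 0 := by
      rw [← SymmetryProjection.singletProj_mulVec_of_spinSq_mulVec_eq_zero hS0, ← hP, hPv]
    rw [hv0, dotProduct_zero] at hv1
    exact zero_ne_one hv1
  have hμ2 : 2 ≤ μ := by
    have hpos : 0 < μ := lt_of_le_of_ne hμ0 (Ne.symm hμne)
    nlinarith
  -- Rayleigh on `W`
  have hR := minEnergyOn_mul_le_re_rayleigh spinSq_isHermitian' W hψ₁W
  rw [← hμ, hray] at hR
  have hnn : 0 ≤ (star ψ₁ ⬝ᵥ ψ₁).re := (Complex.nonneg_iff.1 (dotProduct_star_self_nonneg _)).1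
  nlinarith

end SpinAlgebra

/-! ## §2 The singlet energy bound from a spin-contaminated sector trial state -/

variable {k : ℕ}

/-- Orthogonal splitting of the norm along a Hermitian idempotent: `⟨ψ,ψ⟩ = ⟨Pψ,Pψ⟩ + ⟨ψ−Pψ, ψ−Pψ⟩`. [folklore] -/
private theorem norm_split {ι : Type*} [Fintype ι] [DecidableEq ι] {P : Matrix ι ι ℂ} (hP : Pᴴ = P)
    (hPP : P * P = P) (ψ : ι → ℂ) :
    star ψ ⬝ᵥ ψ = star (P *ᵥ ψ) ⬝ᵥ (P *ᵥ ψ) + star (ψ - P *ᵥ ψ) ⬝ᵥ (ψ - P *ᵥ ψ) := by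
  have h1 : star (P *ᵥ ψ) ⬝ᵥ (P *ᵥ ψ) = star ψ ⬝ᵥ (P *ᵥ ψ) := by
    rw [star_mulVec, hP, ← dotProduct_mulVec, mulVec_mulVec, hPP]
  have h2 : star (P *ᵥ ψ) ⬝ᵥ ψ = star ψ ⬝ᵥ (P *ᵥ ψ) := by
    rw [star_mulVec, hP, ← dotProduct_mulVec]
  rw [star_sub, sub_dotProduct, dotProduct_sub, dotProduct_sub, h1, h2]
  ring

/-- Splitting of an expectation along a Hermitian idempotent commuting with `A`:
`⟨ψ,Aψ⟩ = ⟨Pψ, A Pψ⟩ + ⟨ψ−Pψ, A(ψ−Pψ)⟩`. [folklore] -/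
private theorem expect_split {ι : Type*} [Fintype ι] [DecidableEq ι] {P A : Matrix ι ι ℂ} (hP : Pᴴ = P)
    (hPP : P * P = P) (hPA : Commute P A) (ψ : ι → ℂ) :
    star ψ ⬝ᵥ (A *ᵥ ψ) =
      star (P *ᵥ ψ) ⬝ᵥ (A *ᵥ (P *ᵥ ψ)) + star (ψ - P *ᵥ ψ) ⬝ᵥ (A *ᵥ (ψ - P *ᵥ ψ)) := by
  have hAP : A * P = P * A := hPA.eq.symm
  have h1 : star (P *ᵥ ψ) ⬝ᵥ (A *ᵥ (P *ᵥ ψ)) = star ψ ⬝ᵥ ((A * P) *ᵥ ψ) := by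
    rw [star_mulVec, hP, ← dotProduct_mulVec, mulVec_mulVec, mulVec_mulVec, ← hAP, Matrix.mul_assoc, hPP]
  have h2 : star (P *ᵥ ψ) ⬝ᵥ (A *ᵥ ψ) = star ψ ⬝ᵥ ((A * P) *ᵥ ψ) := by
    rw [star_mulVec, hP, ← dotProduct_mulVec, mulVec_mulVec, hAP]
  have h3 : star ψ ⬝ᵥ (A *ᵥ (P *ᵥ ψ)) = star ψ ⬝ᵥ ((A * P) *ᵥ ψ) := by rw [mulVec_mulVec]
  rw [star_sub, sub_dotProduct, mulVec_sub, dotProduct_sub, dotProduct_sub, h1, h2, h3]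
  ring

/-- **The singlet energy from a spin-contaminated trial state.** For a symmetric model, `n ≤ k`, a
vector `ψ` of the `(n, n)` sector, any `B ≤ E₀(n, n)` and any `s ≥ ‖Ŝ_+ψ‖²`:
`E₀(N = 2n, S = 0) · (⟨ψ,ψ⟩ − s/2) ≤ Re⟨ψ, H_Fψ⟩ − B · s/2`. -/
theorem Model.singletEnergy_mul_le_of_spin_bound {F : Model k} (hF : F.IsSymmetric) {n : ℕ} (hn : n ≤ k)
    {ψ : Fock (Orb (Fin k))} (hψ : IsInSector n n ψ) {B : ℝ} (hB : B ≤ F.energy n n) {s : ℝ}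
    (hs : (star (spinPlus *ᵥ ψ) ⬝ᵥ (spinPlus *ᵥ ψ)).re ≤ s) :
    F.singletEnergy n * ((star ψ ⬝ᵥ ψ).re - s / 2) ≤
      (star ψ ⬝ᵥ F.hamiltonian *ᵥ ψ).re - B * (s / 2) := by
  classical
  set H := F.hamiltonian with hHdef
  have hH : H.IsHermitian := Model.hamiltonian_isHermitian hF
  set P : Matrix (Finset (Orb (Fin k))) (Finset (Orb (Fin k))) ℂ := singletProj with hPdef
  have hPP : P * P = P := SymmetryProjection.singletProj_mul_self
  have hPh : Pᴴ = P := SymmetryProjection.singletProj_conjTranspose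
  have hHS : Commute H spinSq := molecularHamiltonian_commute_spinSq _ _ _
  have hPH : Commute P H :=
    singletProj_commute_of_commute_spinSq hHS (by rw [hH.eq]; exact hHS)
  -- sector bookkeeping
  have hψV : ψ ∈ szSector (n + n) 0 := by
    have h := (mem_szSector_iff_isInSector n n ψ).2 hψ
    rwa [sub_self, zero_div] at h
  set ψ₀ := P *ᵥ ψ with hψ₀
  set ψ₁ := ψ - P *ᵥ ψ with hψ₁
  have hψ₀V : ψ₀ ∈ szSector (n + n) 0 := singletProj_mulVec_mem_szSector hψV
  have hψ₀K : ψ₀ ∈ singletSector k n := by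
    rw [mem_singletSector_iff, sub_self, zero_div]
    refine ⟨hψ₀V, ?_⟩
    exact (spin_mulVec_eq_zero_of_spinSq_mulVec_eq_zero
      (SymmetryProjection.spinSq_mulVec_singletProj_mulVec ψ)).1
  have hψ₁S : IsInSector n n ψ₁ := by
    have h1 : ψ₁ ∈ szSector (n + n) (((n : ℝ) - n) / 2) := by
      rw [sub_self, zero_div]; exact Submodule.sub_mem _ hψV hψ₀V
    exact (mem_szSector_iff_isInSector n n ψ₁).1 h1
  -- the three Rayleigh facts and the contamination bound
  have hE0 : F.singletEnergy n * (star ψ₀ ⬝ᵥ ψ₀).re ≤ (star ψ₀ ⬝ᵥ H *ᵥ ψ₀).re :=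
    minEnergyOn_mul_le_re_rayleigh hH _ hψ₀K
  have hE1 : F.energy n n * (star ψ₁ ⬝ᵥ ψ₁).re ≤ (star ψ₁ ⬝ᵥ H *ᵥ ψ₁).re :=
    sectorGroundEnergy_mul_le_re_rayleigh hH hψ₁S
  have hES : F.energy n n ≤ F.singletEnergy n := Model.energy_le_singletEnergy hF hn
  have hx : 2 * (star ψ₁ ⬝ᵥ ψ₁).re ≤ (star (spinPlus *ᵥ ψ) ⬝ᵥ (spinPlus *ᵥ ψ)).re :=
    two_mul_norm_sub_singletProj_le hψV
  have hx0 : 0 ≤ (star ψ₁ ⬝ᵥ ψ₁).re := (Complex.nonneg_iff.1 (dotProduct_star_self_nonneg _)).1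
  have hsp0 : 0 ≤ (star (spinPlus *ᵥ ψ) ⬝ᵥ (spinPlus *ᵥ ψ)).re :=
    (Complex.nonneg_iff.1 (dotProduct_star_self_nonneg _)).1
  -- splittings
  have hN : (star ψ ⬝ᵥ ψ).re = (star ψ₀ ⬝ᵥ ψ₀).re + (star ψ₁ ⬝ᵥ ψ₁).re := by
    rw [norm_split hPh hPP ψ, Complex.add_re]
  have hEn : (star ψ ⬝ᵥ H *ᵥ ψ).re = (star ψ₀ ⬝ᵥ H *ᵥ ψ₀).re + (star ψ₁ ⬝ᵥ H *ᵥ ψ₁).re := by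
    rw [expect_split hPh hPP hPH ψ, Complex.add_re]
  rw [hN, hEn]
  nlinarith [mul_nonneg (sub_nonneg.2 hES) (sub_nonneg.2 (by linarith : (star ψ₁ ⬝ᵥ ψ₁).re ≤ s / 2)),
    mul_nonneg (sub_nonneg.2 hB) (by linarith : (0 : ℝ) ≤ s)]

/-! ## §3 The certificate predicate and soundness of singlet upper rows from spin-contaminated states -/

/-- **SINGLET UPPER certificate from a spin-contaminated state** (var-2's qc-upper-v0 + singlet value,
FORMAT-qcmps0 §4b): an explicit vector `ψ` of the `(n, n)` sector together with a real `s` such that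
`‖Ŝ_+ψ‖² ≤ s < 2⟨ψ,ψ⟩` and `Re⟨ψ,H_Fψ⟩ − B·s/2 ≤ hi · (⟨ψ,ψ⟩ − s/2)`, for a given rational `B` that is
SEPARATELY certified as a sector lower bound (`LowerRow F n n B`). -/
def SingletUpperCertificateSpin (F : Model k) (n : ℕ) (B hi : ℚ) : Prop :=
  ∃ (ψ : Fock (Orb (Fin k))) (s : ℝ), IsInSector n n ψ ∧
    (star (spinPlus *ᵥ ψ) ⬝ᵥ (spinPlus *ᵥ ψ)).re ≤ s ∧ s / 2 < (star ψ ⬝ᵥ ψ).re ∧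
    (star ψ ⬝ᵥ F.hamiltonian *ᵥ ψ).re - (B : ℝ) * (s / 2) ≤ ((hi : ℚ) : ℝ) * ((star ψ ⬝ᵥ ψ).re - s / 2)

/-- **SOUNDNESS**: a spin-contaminated singlet upper certificate with an admissible `B` (any certified
sector lower row) gives a SINGLET upper row `E₀(H_F; N = 2n, S = 0) ≤ hi`. -/
theorem singletUpperRow_of_spinCertificate {F : Model k} (hF : F.IsSymmetric) {n : ℕ} {B hi : ℚ}
    (hB : LowerRow F n n B) (h : SingletUpperCertificateSpin F n B hi) : SingletUpperRow F n hi := by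
  obtain ⟨ψ, s, hψ, hs, hpos, hq⟩ := h
  have hn : n ≤ k := hB.range.1
  have hmain := Model.singletEnergy_mul_le_of_spin_bound hF hn hψ hB.le hs
  refine ⟨hn, le_of_mul_le_mul_right ?_ (sub_pos.2 hpos)⟩
  exact hmain.trans hq

/-- The same with `B` supplied by a sector LOWER CERTIFICATE (the usual pairing in `Certificates/`). -/
theorem singletUpperRow_of_spinCertificate' {F : Model k} (hF : F.IsSymmetric) {n : ℕ} (hn : n ≤ k)
    {B hi : ℚ} (hB : LowerCertificate F n n B) (h : SingletUpperCertificateSpin F n B hi) :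
    SingletUpperRow F n hi :=
  singletUpperRow_of_spinCertificate hF (lowerRow_of_certificate hF hn hn hB) h
/-- Monotonicity in `B`: a certificate written with a weaker admissible `B' ≤ B` remains valid with `B`
(so the file may quote the crude `E_core − Σ|c_t|` bound while Lean uses any certified row). -/
theorem SingletUpperCertificateSpin.mono_B {F : Model k} {n : ℕ} {B B' hi : ℚ} (hle : B' ≤ B)
    (h : SingletUpperCertificateSpin F n B' hi) : SingletUpperCertificateSpin F n B hi := by
  obtain ⟨ψ, s, hψ, hs, hpos, hq⟩ := h
  refine ⟨ψ, s, hψ, hs, hpos, le_trans ?_ hq⟩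
  have hs0 : 0 ≤ s := le_trans (Complex.nonneg_iff.1 (dotProduct_star_self_nonneg _)).1 hs
  have hle' : ((B' : ℚ) : ℝ) ≤ ((B : ℚ) : ℝ) := by exact_mod_cast hle
  nlinarith

end Summit.Ventures.CertifiedQuantumChemistry

end
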